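import Literature.Probability.LatticeModels.IsingTruncatedPairLowerBound
import HarnessLib

/-!
# The high-temperature expansion of the ferromagnetic spin system `ν_{Λ;K}` and Griffiths' product
# bound over a family of interaction terms

For the spin system `ν_{Λ;K} ∝ exp{∑ᵢ Kᵢ ω_{Cᵢ}}` of Friedli–Velenik 2017 §3.8.1 (the tree's
`gksSum` ∕ `gksExpect`, `GKSInequalities.lean`):

* §1 **High-temperature (character) expansion of spin-product expectations** — the finite form of
  eq. (3.56) in the proof of F–V Thm. 3.49 (p. 142), carried to the end: with
  `e^{Kᵢω_{Cᵢ}} = cosh Kᵢ + ω_{Cᵢ} sinh Kᵢ` (tree `gksWeight_eq_sum_powerset`) and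
  `∑_ω ∏_x ω_x^{m_x} = 2^{|Λ|} 1{all m_x even}`,
  `Z⟨σ_A⟩ = 2^{|Λ|} ∑_{S ⊆ s : A + ∑_{i∈S} Cᵢ ≡ 0 (mod 2)} (∏_{i∈S} sinh Kᵢ)(∏_{i∉S} cosh Kᵢ)`
  (`gksSum_spinProduct_eq_htSum`), hence for a constant coupling `Kᵢ = β`
  `⟨σ_A⟩ = ∑_{S : A + ∑_S Cᵢ ≡ 0} (tanh β)^{|S|} ∕ ∑_{S : ∑_S Cᵢ ≡ 0} (tanh β)^{|S|}`
  (`gksExpect_spinProduct_eq_htRatio_const`) — the random-current ∕ random-surface form used to match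
  the tree's surface representation of free-boundary `ℤ₂` lattice gauge theory
  (`Z2Duality.zdExpect_z2_prod_plaqSpin_eq`).
* §2 **The odd-cover set of a family of interaction terms** `D_Q = {x : #{i ∈ Q : x ∈ Cᵢ} odd}`:
  `∏_{i∈Q} ω_{Cᵢ} = ω_{D_Q}` (`prod_spinProduct_eq_spinProduct_oddCover`), `D_{insert i Q} = Cᵢ ∆ D_Q`,
  and **Griffiths' product bound** `⟨σ_{D_Q}⟩_K ≥ ∏_{i∈Q} tanh Kᵢ` for `Kᵢ ≥ 0`
  (`prod_tanh_le_gksExpect_oddCover`, GKS II along the family + the single-term comparison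
  `tanh_le_gksExpect_single` of `IsingTruncatedPairLowerBound.lean`; R. B. Griffiths, J. Math. Phys.
  8 (1967) 484, «`⟨σ_Aσ_B…⟩ ≥ ⟨σ_A⟩⟨σ_B⟩…`» iterated).

No definitions (the sets are written as `Finset.filter`s), no named facts.

## References

* S. Friedli, Y. Velenik, *Statistical Mechanics of Lattice Systems*, CUP (2017), §3.7.3 eq. (3.44)
  and §3.8.1 Thm. 3.49 with its proof (pp. 124, 141–142). [FriedliVelenik2017]
* R. B. Griffiths, *Correlations in Ising ferromagnets II*, J. Math. Phys. 8 (1967) 484–489.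
-/

noncomputable section

open Finset
open scoped symmDiff

namespace Literature.Probability.LatticeModels

variable {Λ : Type*} {ι : Type*} [Fintype Λ] [DecidableEq Λ]
variable (s : Finset ι) (K : ι → ℝ) (C : ι → Finset Λ)

/-! ### §1 The high-temperature expansion -/

/-- `∑_{u = ±1} u^m = 2·1{m even}`. [folklore] -/
private theorem sum_unitsInt_pow_eq_ite (m : ℕ) :
    ∑ u : ℤˣ, (((u : ℤ) : ℝ)) ^ m = if Even m then 2 else 0 := by
  rw [UnitsInt.univ, Finset.sum_insert (by decide), Finset.sum_singleton]
  simp only [Units.val_one, Int.cast_one, one_pow, Units.val_neg, Int.cast_neg]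
  rcases Nat.even_or_odd m with h | h
  · rw [h.neg_one_pow, if_pos h]; norm_num
  · rw [h.neg_one_pow, if_neg (Nat.not_even_iff_odd.2 h)]; norm_num

/-- **`∑_ω ∏_x ω_x^{m_x} = 2^{|Λ|} 1{every m_x is even}`** (the display after (3.56) in the proof of
Friedli–Velenik 2017 Thm. 3.49, p. 142, evaluated rather than estimated). [cite: FriedliVelenik2017, proof of Thm. 3.49, p. 142] -/
theorem sum_prod_spinAt_pow_eq (m : Λ → ℕ) :
    ∑ ω : SpinConfig Λ, ∏ x, spinAt x ω ^ m x =
      if ∀ x, Even (m x) then (2 : ℝ) ^ Fintype.card Λ else 0 := by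
  have h : ∑ ω : SpinConfig Λ, ∏ x, spinAt x ω ^ m x = ∏ x : Λ, ∑ u : ℤˣ, (((u : ℤ) : ℝ)) ^ m x := by
    rw [Fintype.prod_sum]; rfl
  rw [h]
  simp_rw [sum_unitsInt_pow_eq_ite]
  split_ifs with hall
  · rw [Finset.prod_ite, Finset.prod_const, Finset.prod_const,
      Finset.filter_true_of_mem (fun x _ => hall x), Finset.filter_false_of_mem (fun x _ => by
        simpa using hall x)]
    simp
  · push Not at hall
    obtain ⟨x, hx⟩ := hall
    exact Finset.prod_eq_zero (Finset.mem_univ x) (if_neg hx)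

/-- **`∑_ω ω_A ∏_{i∈S} ω_{Cᵢ} = 2^{|Λ|} · 1{A + ∑_{i∈S} Cᵢ ≡ 0 pointwise mod 2}`** (Friedli–Velenik
2017, proof of Thm. 3.49, p. 142: «`ω_A ∏_C ω_C^{n_C} = ∏_i ω_i^{m_i}`» and the parity evaluation).
[cite: FriedliVelenik2017, proof of Thm. 3.49, p. 142] -/
theorem sum_spinProduct_mul_prod_spinProduct_eq (A : Finset Λ) (S : Finset ι) :
    ∑ ω : SpinConfig Λ, spinProduct A ω * ∏ i ∈ S, spinProduct (C i) ω =
      if ∀ x, Even ((if x ∈ A then 1 else 0) + ∑ i ∈ S, if x ∈ C i then 1 else 0)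
      then (2 : ℝ) ^ Fintype.card Λ else 0 := by
  simp_rw [spinProduct_mul_prod_eq_prod_pow C A S]
  exact sum_prod_spinAt_pow_eq _

/-- **High-temperature expansion of `Z⟨σ_A⟩`** (Friedli–Velenik 2017 eq. (3.44) ∕ proof of Thm. 3.49):
`∑_ω ω_A e^{∑Kᵢω_{Cᵢ}} = 2^{|Λ|} ∑_{S ⊆ s, A + ∑_S Cᵢ ≡ 0} (∏_{i∈S} sinh Kᵢ)(∏_{i∈s∖S} cosh Kᵢ)`.
[cite: FriedliVelenik2017, §3.7.3 eq. (3.44) and proof of Thm. 3.49 (p. 142)] -/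
theorem gksSum_spinProduct_eq_htSum [DecidableEq ι] (A : Finset Λ) :
    gksSum s K C (spinProduct A) =
      (2 : ℝ) ^ Fintype.card Λ * ∑ S ∈ s.powerset with
        (∀ x, Even ((if x ∈ A then 1 else 0) + ∑ i ∈ S, if x ∈ C i then 1 else 0)),
        (∏ i ∈ S, Real.sinh (K i)) * ∏ i ∈ s \ S, Real.cosh (K i) := by
  simp only [gksSum, gksWeight_eq_sum_powerset s K C, Finset.mul_sum]
  rw [Finset.sum_comm, Finset.sum_filter]
  refine Finset.sum_congr rfl fun S _ => ?_
  have h : ∑ ω : SpinConfig Λ, spinProduct A ω *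
      (((∏ i ∈ S, Real.sinh (K i)) * ∏ i ∈ s \ S, Real.cosh (K i)) * ∏ i ∈ S, spinProduct (C i) ω) =
      ((∏ i ∈ S, Real.sinh (K i)) * ∏ i ∈ s \ S, Real.cosh (K i)) *
        ∑ ω : SpinConfig Λ, spinProduct A ω * ∏ i ∈ S, spinProduct (C i) ω := by
    rw [Finset.mul_sum]
    exact Finset.sum_congr rfl fun ω _ => by ring
  rw [h, sum_spinProduct_mul_prod_spinProduct_eq]
  split_ifs <;> ring

/-- For a constant coupling `β` the weights are `(∏_S sinh β)(∏_{s∖S} cosh β) = cosh^{|s|} β · tanh^{|S|} β`.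
[cite: FriedliVelenik2017, §3.7.3 eq. (3.44)] -/
private theorem prod_sinh_mul_prod_cosh_const [DecidableEq ι] (β : ℝ) {S : Finset ι} (hS : S ⊆ s) :
    (∏ _i ∈ S, Real.sinh β) * ∏ _i ∈ s \ S, Real.cosh β = Real.cosh β ^ #s * Real.tanh β ^ #S := by
  rw [Finset.prod_const, Finset.prod_const, Finset.card_sdiff_of_subset hS, Real.tanh_eq_sinh_div_cosh, div_pow]
  have hc : Real.cosh β ≠ 0 := (Real.cosh_pos β).ne'
  have hle : #S ≤ #s := Finset.card_le_card hS
  rw [← pow_sub_mul_pow (Real.cosh β) hle]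
  field_simp

/-- **`⟨σ_A⟩` as a ratio of high-temperature sums, constant coupling** (the random-current ∕
random-surface form): `⟨σ_A⟩_{Λ;β} = ∑_{S : A + ∑_S Cᵢ ≡ 0} tanh(β)^{|S|} ∕ ∑_{S : ∑_S Cᵢ ≡ 0} tanh(β)^{|S|}`.
[cite: FriedliVelenik2017, §3.7.3 eq. (3.44) and proof of Thm. 3.49 (p. 142)] -/
theorem gksExpect_spinProduct_eq_htRatio_const [DecidableEq ι] (β : ℝ) (A : Finset Λ) :
    gksExpect s (fun _ => β) C (spinProduct A) =
      (∑ S ∈ s.powerset with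
          (∀ x, Even ((if x ∈ A then 1 else 0) + ∑ i ∈ S, if x ∈ C i then 1 else 0)),
          Real.tanh β ^ #S) /
        ∑ S ∈ s.powerset with (∀ x, Even (∑ i ∈ S, if x ∈ C i then 1 else 0)), Real.tanh β ^ #S := by
  have h1 : gksSum s (fun _ => β) C (fun _ => (1 : ℝ)) = gksSum s (fun _ => β) C (spinProduct ∅) := by
    show _ = gksSum s (fun _ => β) C (fun ω => spinProduct ∅ ω)
    simp only [spinProduct_empty]
  rw [gksExpect, h1, gksSum_spinProduct_eq_htSum, gksSum_spinProduct_eq_htSum]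
  simp only [Finset.notMem_empty, if_false, zero_add]
  have hnum : ∀ (P : Finset ι → Prop) [DecidablePred P],
      ∑ S ∈ s.powerset with P S, (∏ _i ∈ S, Real.sinh β) * ∏ _i ∈ s \ S, Real.cosh β =
        Real.cosh β ^ #s * ∑ S ∈ s.powerset with P S, Real.tanh β ^ #S := by
    intro P _
    rw [Finset.mul_sum]
    refine Finset.sum_congr rfl fun S hS => ?_
    rw [Finset.mem_filter, Finset.mem_powerset] at hS
    exact prod_sinh_mul_prod_cosh_const s β hS.1
  rw [hnum, hnum]
  have h2 : (0 : ℝ) < (2 : ℝ) ^ Fintype.card Λ := by positivity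
  have hc : (0 : ℝ) < Real.cosh β ^ #s := pow_pos (Real.cosh_pos β) _
  rw [mul_div_mul_left _ _ h2.ne', mul_div_mul_left _ _ hc.ne']

/-! ### §2 The odd-cover set of a family of interaction terms and Griffiths' product bound -/

/-- **`∏_{i∈Q} ω_{Cᵢ} = ω_{D_Q}`** with the odd-cover set `D_Q = {x : #{i ∈ Q : x ∈ Cᵢ} odd}`
(`ω_x² = 1`; Friedli–Velenik 2017 p. 142, «`∏_C ω_C^{n_C} = ∏_i ω_i^{m_i}`»). [cite: FriedliVelenik2017, proof of Thm. 3.49, p. 142] -/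
theorem prod_spinProduct_eq_spinProduct_oddCover [DecidableEq ι] (Q : Finset ι) (ω : SpinConfig Λ) :
    ∏ i ∈ Q, spinProduct (C i) ω =
      spinProduct (univ.filter fun x : Λ => Odd #(Q.filter fun i => x ∈ C i)) ω := by
  have h := spinProduct_mul_prod_eq_prod_pow C ∅ Q ω
  rw [spinProduct_empty, one_mul] at h
  rw [h, spinProduct, ← Finset.prod_filter_mul_prod_filter_not Finset.univ
    (fun x : Λ => Odd #(Q.filter fun i => x ∈ C i))]
  have hcard : ∀ x : Λ, (∑ i ∈ Q, if x ∈ C i then 1 else 0) = #(Q.filter fun i => x ∈ C i) := fun x => by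
    rw [Finset.card_filter]
  simp only [Finset.notMem_empty, if_false, zero_add, hcard]
  have hev : ∏ x ∈ univ.filter (fun x : Λ => ¬Odd #(Q.filter fun i => x ∈ C i)),
      spinAt x ω ^ #(Q.filter fun i => x ∈ C i) = 1 := by
    refine Finset.prod_eq_one fun x hx => ?_
    rw [Finset.mem_filter] at hx
    obtain ⟨k, hk⟩ := Nat.not_odd_iff_even.1 hx.2
    rw [hk, ← two_mul, pow_mul, spinAt_sq, one_pow]
  rw [hev, mul_one]
  refine Finset.prod_congr rfl fun x hx => ?_
  rw [Finset.mem_filter] at hx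
  obtain ⟨k, hk⟩ := hx.2
  rw [hk, pow_succ, pow_mul, spinAt_sq, one_pow, one_mul]

omit [Fintype Λ] in
/-- `D_{insert i Q} = Cᵢ ∆ D_Q` for `i ∉ Q`: adding the term `i` flips the parity `m_x` exactly on
`Cᵢ` (Friedli–Velenik 2017 p. 142, `m_i = 1_{i∈A} + ∑_{C ∋ i} n_C`). [cite: FriedliVelenik2017, proof of Thm. 3.49, p. 142] -/
theorem oddCover_insert [DecidableEq ι] [Fintype Λ] {Q : Finset ι} {i₀ : ι} (hi₀ : i₀ ∉ Q) :
    (univ.filter fun x : Λ => Odd #((insert i₀ Q).filter fun i => x ∈ C i)) =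
      C i₀ ∆ (univ.filter fun x : Λ => Odd #(Q.filter fun i => x ∈ C i)) := by
  ext x
  simp only [Finset.mem_filter, Finset.mem_univ, true_and, Finset.mem_symmDiff]
  rw [Finset.filter_insert]
  by_cases hx : x ∈ C i₀
  · rw [if_pos hx, Finset.card_insert_of_notMem (fun h => hi₀ (Finset.mem_filter.1 h).1),
      Nat.odd_add_one]
    constructor
    · intro h; exact Or.inl ⟨hx, h⟩
    · rintro (⟨-, h⟩ | ⟨h, h'⟩)
      · exact h
      · exact absurd hx h'
  · rw [if_neg hx]
    constructor
    · intro h; exact Or.inr ⟨h, hx⟩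
    · rintro (⟨h, -⟩ | ⟨h, -⟩)
      · exact absurd h hx
      · exact h

/-- `D_∅ = ∅` (no interaction terms, all parities even; Friedli–Velenik 2017 p. 142).
[cite: FriedliVelenik2017, proof of Thm. 3.49, p. 142] -/
theorem oddCover_empty [DecidableEq ι] :
    (univ.filter fun x : Λ => Odd #((∅ : Finset ι).filter fun i => x ∈ C i)) = ∅ := by
  ext x; simp

/-- **Griffiths' product bound**: for `Kᵢ ≥ 0` and any family `Q ⊆ s` of interaction terms,
`⟨∏_{i∈Q} σ_{Cᵢ}⟩_{Λ;K} = ⟨σ_{D_Q}⟩_{Λ;K} ≥ ∏_{i∈Q} tanh Kᵢ` — GKS II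
`⟨σ_{Cᵢ}σ_{D}⟩ ≥ ⟨σ_{Cᵢ}⟩⟨σ_D⟩` along the family and the single-term comparison
`⟨σ_{Cᵢ}⟩ ≥ tanh Kᵢ` (R. B. Griffiths 1967 II; Friedli–Velenik 2017 Thm. 3.49 (3.55) + Exercise 3.31).
[cite: FriedliVelenik2017, Thm. 3.49 and Exercise 3.31, pp. 141–142] -/
theorem prod_tanh_le_gksExpect_oddCover [DecidableEq ι] (hK : ∀ i ∈ s, 0 ≤ K i) {Q : Finset ι}
    (hQ : Q ⊆ s) :
    ∏ i ∈ Q, Real.tanh (K i) ≤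
      gksExpect s K C (spinProduct (univ.filter fun x : Λ => Odd #(Q.filter fun i => x ∈ C i))) := by
  induction Q using Finset.induction_on with
  | empty =>
    rw [Finset.prod_empty, oddCover_empty]
    have h1 : spinProduct (∅ : Finset Λ) = fun _ : SpinConfig Λ => (1 : ℝ) := by
      funext ω; exact spinProduct_empty ω
    rw [h1, gksExpect, div_self (gksSum_one_pos s K C).ne']
  | insert i₀ Q hi₀ ih =>
    have hi₀s : i₀ ∈ s := hQ (Finset.mem_insert_self _ _)
    have hQs : Q ⊆ s := fun i hi => hQ (Finset.mem_insert_of_mem hi)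
    have htanh : 0 ≤ Real.tanh (K i₀) := by
      rw [Real.tanh_eq_sinh_div_cosh]
      exact div_nonneg (Real.sinh_nonneg_iff.2 (hK i₀ hi₀s)) (Real.cosh_pos _).le
    rw [Finset.prod_insert hi₀, oddCover_insert C hi₀]
    calc Real.tanh (K i₀) * ∏ i ∈ Q, Real.tanh (K i)
        ≤ gksExpect s K C (spinProduct (C i₀)) *
            gksExpect s K C (spinProduct (univ.filter fun x : Λ => Odd #(Q.filter fun i => x ∈ C i))) :=
          mul_le_mul (tanh_le_gksExpect_single s K C hK hi₀s) (ih hQs)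
            (Finset.prod_nonneg fun i hi => by
              rw [Real.tanh_eq_sinh_div_cosh]
              exact div_nonneg (Real.sinh_nonneg_iff.2 (hK i (hQs hi))) (Real.cosh_pos _).le)
            (gksExpect_spinProduct_nonneg s K C hK _)
      _ ≤ _ := gksExpect_mul_gksExpect_le s K C hK _ _

end Literature.Probability.LatticeModels
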